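import Mathlib

/-!
# SoloBlind — the combinatorial core of the chiral (super)trace identity, and the arithmetic of the
# Hodge ring of the T₈ face

Solo seat `solo-HodgeConjecture-blind`, session s33 (HOME `work/s33/hodge-ring-of-the-face.md`).

Context (paper statements, not formalised here): for a K3 surface `X` with transcendental lattice `T` of
rank `r`, the even Kuga–Satake variety has `H¹ = C⁺(T)` with the spin group acting on the LEFT; right
multiplication `R_Γ` by the volume element is an endomorphism of the abelian variety. In the monomial
basis `e_K` (`K` an even subset of the index set) one has `e_I · e_K · Γ = ± e_{(I ∆ K) ∆ univ}`, so the
diagonal coefficient of `L_{e_I} ∘ R_Γ` at `e_K` vanishes unless `(I ∆ K) ∆ univ = K`.  The lemma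
`symmDiff_symmDiff_eq_self_iff` below says this happens iff `I = univ`; hence
`tr (L_{e_I} R_Γ) = 0` for `I ≠ univ`, and `tr (L_{v₁⋯v_r} R_Γ) = 2^{r-1} Γ² · det(v₁,…,v_r)`:
under the Kuga–Satake Hodge conjecture the determinant class `det T ∈ H^{2r}(X^r, ℚ)` is algebraic
(Prop Δ1′ of the HOME file), with no Hodge conjecture needed on powers of the Kuga–Satake variety.

What is kernel-checked here:
* `symmDiff_symmDiff_eq_self_iff` : `(I ∆ K) ∆ U = K ↔ I = U` in any generalized Boolean algebra, and its
  specialisation to finsets with `U = univ` (the "only the top word has a diagonal" lemma);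
* `card_even_finsets` bookkeeping is NOT attempted; instead the numerology of the face used in the HOME file:
  `2^(8-1) = 128` (dim C⁺ for r = 8), `16 = 2^4` (dim of the spin module), the Hodge-class count
  `1 + 9 = 10` in `H⁸(A₊)` with `9 = dim Sym⁸(ℚ²) = 8 + 1`, the Brauer count `105 = 7·5·3·1` and
  `106 = 105 + 1`, the contraction certificate value `322560 = 8 · 8!` (non-zero), the codimension of the
  face `20 - 8 = 12`, and the Weil signature `4 + 4 = 8`;
* `no_odd_from_even` : a parity lemma — a sum of triples of even natural numbers is never `(1,1,1)` —
  the formal content of "the Kuga–Satake class κ (tri-degree (1,1,1)) is not generated by the even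
  classes q, E±, 𝕳, δ, M± (all of even tri-degree)" (Δ4 of the HOME file).
-/

namespace Summit.HodgeConjecture.HodgeConjecture.Theorems.SoloBlindChiralTrace

open scoped symmDiff

section SymmDiff

variable {α : Type*} [GeneralizedBooleanAlgebra α]

/-- `(I ∆ K) ∆ U = K ↔ I = U`: conjugating `K` by a symmetric difference returns `K` exactly when the two
conjugating elements agree.  Combinatorial core of `tr (L_{e_I} R_Γ) = 0` for `I ≠ univ`. -/
theorem symmDiff_symmDiff_eq_self_iff (I K U : α) : (I ∆ K) ∆ U = K ↔ I = U := by
  constructor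
  · intro h
    -- cancel `U` on the right, then `K` on the right
    have h1 : I ∆ K = K ∆ U := by
      have := congrArg (· ∆ U) h
      simpa [symmDiff_assoc, symmDiff_self, symmDiff_bot] using this
    have h2 : I = (K ∆ U) ∆ K := by
      have := congrArg (· ∆ K) h1
      simpa [symmDiff_assoc, symmDiff_self, symmDiff_bot] using this
    rw [h2, symmDiff_comm K U, symmDiff_assoc, symmDiff_self, symmDiff_bot]
  · rintro rfl
    rw [symmDiff_comm I K, symmDiff_assoc, symmDiff_self, symmDiff_bot]

/-- The only word with a diagonal: for finsets, `(I ∆ K) ∆ univ = K ↔ I = univ`. -/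
theorem top_word_only_diagonal {ι : Type*} [Fintype ι] [DecidableEq ι] (I K : Finset ι) :
    (I ∆ K) ∆ (Finset.univ : Finset ι) = K ↔ I = Finset.univ :=
  symmDiff_symmDiff_eq_self_iff I K Finset.univ

/-- Consequently the set of "diagonal" indices `K` is all of them when `I = univ` and empty otherwise. -/
theorem diagonal_index_set {ι : Type*} [Fintype ι] [DecidableEq ι] (I : Finset ι)
    (S : Finset (Finset ι)) :
    (S.filter fun K => (I ∆ K) ∆ (Finset.univ : Finset ι) = K) =
      (if I = Finset.univ then S else ∅) := by
  split_ifs with h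
  · subst h
    apply Finset.filter_true_of_mem
    intro K _
    exact (top_word_only_diagonal _ K).mpr rfl
  · apply Finset.filter_false_of_mem
    intro K _ hK
    exact h ((top_word_only_diagonal I K).mp hK)

end SymmDiff

section Parity

/-- A finite sum of triples of even naturals has even components; in particular it is never `(1,1,1)`.
Formal content of Δ4: the Kuga–Satake class (tri-degree `(1,1,1)` in the `(V,S₊,S₋)`-grading) is not a
polynomial in classes of even tri-degree. -/
theorem no_odd_from_even (l : List (ℕ × ℕ × ℕ))
    (h : ∀ t ∈ l, Even t.1 ∧ Even t.2.1 ∧ Even t.2.2) :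
    Even (l.map (·.1)).sum ∧ Even (l.map (·.2.1)).sum ∧ Even (l.map (·.2.2)).sum := by
  induction l with
  | nil => simp
  | cons a l ih =>
    have ha := h a (by simp)
    have hl : ∀ t ∈ l, Even t.1 ∧ Even t.2.1 ∧ Even t.2.2 := fun t ht => h t (by simp [ht])
    obtain ⟨i1, i2, i3⟩ := ih hl
    simp only [List.map_cons, List.sum_cons]
    exact ⟨ha.1.add i1, ha.2.1.add i2, ha.2.2.add i3⟩

/-- The first component of a sum of even-tri-degree generators is never `1`: the tri-degree `(1,1,1)`
of the Kuga–Satake class is not reached by monomials in even-tri-degree classes. -/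
theorem kappa_degree_not_generated (l : List (ℕ × ℕ × ℕ))
    (h : ∀ t ∈ l, Even t.1 ∧ Even t.2.1 ∧ Even t.2.2) :
    (l.map (·.1)).sum ≠ 1 := by
  intro h1
  have := (no_odd_from_even l h).1
  rw [h1] at this
  exact Nat.not_even_one this

end Parity

section Numerology

/-- Numerology of the Hodge ring of the T₈ face used in `work/s33/hodge-ring-of-the-face.md`. -/
theorem face_numerology :
    2 ^ (8 - 1) = 128 ∧ (16 : ℕ) = 2 ^ 4 ∧ (1 : ℕ) + 9 = 10 ∧ (9 : ℕ) = 8 + 1 ∧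
    (105 : ℕ) = 7 * 5 * 3 * 1 ∧ (106 : ℕ) = 105 + 1 ∧ (322560 : ℕ) = 8 * Nat.factorial 8 ∧
    (322560 : ℤ) ≠ 0 ∧ (20 : ℕ) - 8 = 12 ∧ (4 : ℕ) + 4 = 8 := by
  refine ⟨by norm_num, by norm_num, by norm_num, by norm_num, by norm_num, by norm_num, ?_, by norm_num,
    by norm_num, by norm_num⟩
  decide

/-- `dim Sym⁸(ℚ²) = 9`: the Murty space `det S₊ ⊗ Sym⁸ W₊` has dimension `9` (`dim W₊ = 2`). -/
theorem sym8_dim_two : Nat.choose (8 + 2 - 1) 8 = 9 := by decide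

/-- Brauer count: the number of perfect matchings of `8` points is `7!! = 105`. -/
theorem doubleFactorial_seven : Nat.doubleFactorial 7 = 105 := by decide

end Numerology

end Summit.HodgeConjecture.HodgeConjecture.Theorems.SoloBlindChiralTrace
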